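import Summits.CriticalPhenomena.PercolationContinuityZ3.Theorems.FK.WiredMinimalOnFiniteClusters
import Summits.CriticalPhenomena.PercolationContinuityZ3.Theorems.FK.InfiniteVolumeOneEdgeDLRClosed
import Summits.CriticalPhenomena.PercolationContinuityZ3.Theorems.FK.GibbsThetaSandwich
import Summits.CriticalPhenomena.PercolationContinuityZ3.Theorems.FK.FreeWiredCoincidence
import Summits.CriticalPhenomena.PercolationContinuityZ3.Theorems.FK.InfiniteVolumeDLREquation
import HarnessLib

/-!
# FK-continuity cell, FO-10a: `θ⁰(p,q) = θ¹(p,q)` implies `φ⁰_{p,q} = φ¹_{p,q}` —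
# Grimmett 2006, Thm. (5.16)(c) ('only if') = Thm. (5.33)(a): equal percolation probabilities force a
# unique random-cluster measure (coupling-free proof)

Registered R76 (cell INBOX l.5704, 2026-08-23); registry row FO-10a-g336; label THU-C (coordinator fk-4 g167).
Cell `fk-continuity` (bschramm), row FO-10a (domain-Markov + comparison layer over FO-06); support file
for the FK-continuity transplant (`--supports stmt-CriticalPhenomena-4575`); builds on p205010 (kernel
theorem, internal audit signed; external expert review pending). Pure proofs; no definitions, no named
facts, no sorries; general dimension `d`.

Grimmett 2006, Thm. (5.16)(c): for `q ≥ 1`, `θ⁰(p,q) = θ¹(p,q)` **iff** `p ∉ 𝒟_q`, i.e. iff `φ⁰_{p,q} = φ¹_{p,q}`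
(Thm. (4.63)); Thm. (5.33)(a): hence `|W_{p,q}| = |R_{p,q}| = 1` whenever `θ⁰(p,q) = θ¹(p,q)`. The tree had the
'if' half (`thetaFree_eq_thetaWired_of_rcLimit_false_eq_rcLimit_true`, FO-07b) and named the seam
`FK.FKUniqueAt d p q := θ⁰(p,q) = θ¹(p,q)` after the 'only if' half without proving it; the case `θ¹ = 0` is
`UniquenessOfNonPercolationTheta.lean`. This file proves the 'only if' half in full:

* **`rcLimit_false_eq_rcLimit_true_of_thetaFree_eq_thetaWired`**: `θ⁰(p,q) = θ¹(p,q) ⇒ φ⁰_{p,q} = φ¹_{p,q}`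
  (`0 ≤ p ≤ 1`, `q ≥ 1`, every `d`); `rcLimit_false_eq_rcLimit_true_iff_thetaFree_eq_thetaWired` (Thm. (5.16)(c));
  **`fkUniqueAt_iff_rcLimit_false_eq_rcLimit_true`** (the cell's seam IS uniqueness of the infinite-volume
  measure); `fkGibbs_iff_eq_rcLimit_false_of_thetaFree_eq_thetaWired` (the sandwich class is then a singleton,
  Thm. (5.33)(a) on the cell's class); `setOf_rcLimit_false_ne_rcLimit_true_eq` (`𝒟_q = {p : θ⁰(p,q) ≠ θ¹(p,q)}`);
  `thetaFree_lt_thetaWired_of_rcLimit_false_ne_rcLimit_true` (phase coexistence forces `θ⁰ < θ¹`).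

Proof (Grimmett's pp. 103–104 with BOTH couplings removed). Fix a lattice edge `e = ⟨u,v⟩`; by Thm. (4.63)
(`rcLimit_false_eq_rcLimit_true_iff_of_mem_edgeSet`) it suffices to show `h¹(e) ≤ h⁰(e)`, i.e.
`φ¹(J_e) ≤ φ⁰(J_e)`. Split `J_e = (J_e ∩ I_u ∩ I_v) ⊔ (J_e ∩ {u ↛ ∞, v ↛ ∞})` (`I_w = {w ↔ ∞}`; on `J_e` the
clusters of `u` and `v` coincide).
* `φ¹(J_e; u ↛ ∞, v ↛ ∞) ≤ φ⁰(J_e; u ↛ ∞, v ↛ ∞)` is the companion file's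
  `rcLimit_true_real_inter_finiteClusters_le_rcLimit_false` (free islands; replaces Prop. (5.30)'s coupling `ψ_Δ`).
* With `H = {u ↔ ∞ and v ↔ ∞ in ω ∖ e}` (increasing, `e`-independent): `φ^b(J_eᶜ ∩ I_u ∩ I_v) = φ^b(J_eᶜ ∩ H)` and,
  by the one-edge DLR equation of `φ^b_{p,q}` (`IsBoxLimit.real_edgeOpen_inter_offEdgeConn_eq_mul`, Grimmett's (4.38),
  passed to the non-local `H` along `{u ↔ ∂Λ_n, v ↔ ∂Λ_n off e} → H`) and the a.s. uniqueness of the infinite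
  cluster of `ω ∖ e` (Burton–Keane + deletion tolerance, `IsBoxLimit.real_preimage_diff_not_numInfiniteClusters_le_one`):
  `φ^b(J_e ∩ H) = p · φ^b(H)`, whence **`φ^b(J_e ∩ I_u ∩ I_v) = φ^b(I_u ∩ I_v) − (1 − p) φ^b(H)`**
  (`IsBoxLimit.real_edgeOpen_inter_percolatesAt_eq`; this is (5.24)–(5.25));
* inclusion–exclusion replaces the coupling (5.22): `φ^b(I_u ∩ I_v) = φ^b(I_u) + φ^b(I_v) − φ^b(I_u ∪ I_v)` with
  `φ¹(I_w) = θ¹ = θ⁰ = φ⁰(I_w)` (`FKGibbs.real_percolatesAt_eq_of_thetaFree_eq_thetaWired`) and `I_u ∪ I_v`, `H`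
  increasing (`φ⁰ ≤st φ¹`, `InfiniteVolumeStochasticOrder.lean`) give `φ¹(J_e ∩ I_u ∩ I_v) ≤ φ⁰(J_e ∩ I_u ∩ I_v)`.
Adding: `h¹(e) ≤ h⁰(e) ≤ h¹(e)`. (`p = 1`: all lattice edges are a.s. open under both limits; `d = 0`: no edges.)

Honest framing: unconditional infinite-volume structure (Grimmett 2006 §5.2–§5.3); it DECIDES NOTHING about
`T_F(q)` / `T_W(q)` / whether `θ⁰(p_c(q),q) = θ¹(p_c(q),q)` for `q ∈ (1,2)` (Raoufi 2020 Q4 open); NOT a binder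
discharge; the `q = 2`, `d ≥ 3` critical instance is already `UniquenessCriticalFKIsing.lean`.

## References
* G. Grimmett, *The Random-Cluster Model*, Springer 2006 (`book:grimmett2006-random-cluster-model`): Thm. (4.63);
  §5.2 Thm. (5.16)(c) and its proof, eqs. (5.20)–(5.29), Prop. (5.30) [PDF pp. 101–107]; §5.3 Thm. (5.33)(a),
  Conj. (5.34) [PDF p. 107]; Prop. (4.37) eq. (4.38), Thm. (4.33)(c). [Grimmett2006]
* G. Grimmett, Ann. Probab. 23 (1995) 1461–1510, Thm. 5.2 ([152] of the book). [Grimmett1995]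
-/

noncomputable section

open MeasureTheory Set Filter
open scoped Topology ENNReal

namespace Summit.CriticalPhenomena.PercolationContinuityZ3.Theorems.FK

open Literature.Probability.Percolation Literature.Probability.LatticeModels Literature.Barriers.CriticalPhenomena

/-! ## The one-edge DLR equation on `H = {u ↔ ∞, v ↔ ∞ off e}`: `φ^b(J_e ∩ H) = p · φ^b(H)` -/

section OneEdge

variable {d : ℕ} {b : Bool} {p q : ℝ} {P : Measure (BondConfig (Site d))}

/-- **`P(J_e ∩ H) = p · P(H)` for `H = {u ↔ ∞ and v ↔ ∞ in ω ∖ e}`** and every box limit `P` (`0 ≤ p < 1`,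
`q ≥ 1`): the one-edge DLR equation (Grimmett's (4.38), first case: given `T_e`, on `K_e = {u ↔ v off e}` the
edge `e` is open with probability `p`) passed from the local events `{u ↔ ∂Λ_n and v ↔ ∂Λ_n inside Λ_n, off e}`
to their a.s. limit `H`, together with `H ⊆ K_e` a.s. (uniqueness of the infinite cluster of `ω ∖ e`).
[cite: Grimmett2006, Prop. (4.37) eq. (4.38), Thm. (4.33)(c); §5.2 (5.24)–(5.25)] -/
theorem IsBoxLimit.real_edgeOpen_inter_offEdgePerc_eq_mul (hP : IsBoxLimit d b p q P) (hp : p ∈ Set.Ico (0 : ℝ) 1)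
    (hq : 1 ≤ q) {u v : Site d} (huv : (zdGraph d).Adj u v) :
    P.real ({ω | s(u, v) ∈ ω} ∩ (fun η : BondConfig (Site d) => η \ {s(u, v)}) ⁻¹' (percolatesAt u ∩ percolatesAt v)) =
      p * P.real ((fun η : BondConfig (Site d) => η \ {s(u, v)}) ⁻¹' (percolatesAt u ∩ percolatesAt v)) := by
  classical
  haveI := hP.isProbabilityMeasure
  have hp' : p ∈ Set.Icc (0 : ℝ) 1 := ⟨hp.1, hp.2.le⟩
  have hq0 : 0 < q := one_pos.trans_le hq
  set f : BondConfig (Site d) → BondConfig (Site d) := fun η => η \ {s(u, v)} with hf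
  have hfm : Measurable f := measurable_closeEdges _
  set J : Set (BondConfig (Site d)) := {ω | s(u, v) ∈ ω} with hJ
  have hJm : MeasurableSet J := measurableSet_mem _
  set H : Set (BondConfig (Site d)) := f ⁻¹' (percolatesAt u ∩ percolatesAt v) with hH
  have hHm : MeasurableSet H :=
    ((measurableSet_percolatesAt_holds u).inter (measurableSet_percolatesAt_holds v)).preimage hfm
  set K : Set (BondConfig (Site d)) := f ⁻¹' openConn u v with hK
  have hKm : MeasurableSet K := (measurableSet_openConn_holds u v).preimage hfm
  -- the local approximants `H_n = {u ↔ ∂Λ_n and v ↔ ∂Λ_n inside Λ_n, off e}`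
  set R : ℕ → Site d → Set (BondConfig (Site d)) := fun n w =>
    {ω | ∃ y ∈ innerBoundary (zdGraph d) (box d n),
      (openGraph ω ⊓ withinGraph (zdGraph d) (↑(box d n) : Set (Site d))).Reachable y w} with hR
  set Hn : ℕ → Set (BondConfig (Site d)) := fun n => f ⁻¹' (R n u ∩ R n v) with hHn
  have hHn_det : ∀ n, DeterminedBy (Hn n) ↑(edgesIn (zdGraph d) (box d n) \ {s(u, v)}) := by
    intro n
    rw [Finset.coe_sdiff, Finset.coe_singleton]
    exact determinedBy_preimage_diff_singleton
      (((determinedBy_setOf_bdryReach (box d n) u).inter (determinedBy_setOf_bdryReach (box d n) v))) _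
  have hHn_m : ∀ n, MeasurableSet (Hn n) := fun n => measurableSet_of_isLocalEvent_holds ⟨_, hHn_det n⟩
  have heT : ∀ n, s(u, v) ∉ edgesIn (zdGraph d) (box d n) \ {s(u, v)} := fun n h =>
    (Finset.mem_sdiff.1 h).2 (Finset.mem_singleton_self _)
  -- (1) the DLR equation on the local approximants
  have hloc : ∀ n, P.real (J ∩ Hn n ∩ K) = p * P.real (Hn n ∩ K) := fun n =>
    hP.real_edgeOpen_inter_offEdgeConn_eq_mul hp' hq0 huv (hHn_det n) (heT n)
  -- (2) almost surely, `ω ∈ H_n ↔ ω ∈ H` for all large `n`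
  have hae : ∀ᵐ ω ∂P, ∀ᶠ n : ℕ in atTop, (ω ∈ Hn n ↔ ω ∈ H) := by
    filter_upwards [hP.ae_subset_edgeSet hp' hq0] with ω hω
    have hfω : f ω ⊆ (zdGraph d).edgeSet := Set.sdiff_subset.trans hω
    have key : ∀ w : Site d, ∀ᶠ n : ℕ in atTop, (f ω ∈ R n w ↔ f ω ∈ percolatesAt w) := by
      intro w
      filter_upwards [eventually_mem_setOf_forall_not_bdryReach_iff hfω {w}] with n hn
      simp only [Finset.mem_singleton, forall_eq] at hn
      simpa only [hR, Set.mem_setOf_eq] using not_iff_not.1 hn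
    filter_upwards [key u, key v] with n hnu hnv
    simp only [hHn, hH, Set.mem_preimage, Set.mem_inter_iff]
    exact and_congr hnu hnv
  have hlim : ∀ {X Y : Set (BondConfig (Site d))}, MeasurableSet X → MeasurableSet Y →
      Tendsto (fun n => P.real (X ∩ Hn n ∩ Y)) atTop (𝓝 (P.real (X ∩ H ∩ Y))) := by
    intro X Y hX hY
    have h := tendsto_measure_of_ae_tendsto_indicator_of_isFiniteMeasure (μ := P) atTop
      ((hX.inter hHm).inter hY) (fun n => (hX.inter (hHn_m n)).inter hY) ?_
    · exact (ENNReal.tendsto_toReal (measure_ne_top P _)).comp h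
    · filter_upwards [hae] with ω hω
      filter_upwards [hω] with n hn
      simp only [Set.mem_inter_iff]
      exact and_congr (and_congr_right fun _ => hn) Iff.rfl
  -- (3) pass to the limit: `P(J ∩ H ∩ K) = p · P(H ∩ K)`
  have hlimK : P.real (J ∩ H ∩ K) = p * P.real (H ∩ K) := by
    have h1 := hlim hJm hKm
    have h2 : Tendsto (fun n => p * P.real (Set.univ ∩ Hn n ∩ K)) atTop (𝓝 (p * P.real (Set.univ ∩ H ∩ K))) :=
      (hlim MeasurableSet.univ hKm).const_mul p
    simp only [Set.univ_inter] at h2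
    exact tendsto_nhds_unique h1 (h2.congr fun n => (hloc n).symm)
  -- (4) `H ∖ K` is null: two infinite clusters in `ω ∖ e`
  have hnull : P.real (H \ K) = 0 :=
    measureReal_mono_null (preimage_diff_percolatesAt_inter_diff_openConn_subset u v _)
      (hP.real_preimage_diff_not_numInfiniteClusters_le_one hp hq (hP.ae_numInfiniteClusters_le_one' hp' hq) _)
  have hJH : P.real (J ∩ H) = P.real (J ∩ H ∩ K) := by
    rw [← measureReal_inter_add_sdiff (s := J ∩ H) hKm,
      measureReal_mono_null (fun ω hω => ⟨hω.1.2, hω.2⟩ : (J ∩ H) \ K ⊆ H \ K) hnull, add_zero]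
  have hHK : P.real H = P.real (H ∩ K) := by
    rw [← measureReal_inter_add_sdiff (s := H) hKm, hnull, add_zero]
  rw [hJH, hlimK, ← hHK]

/-- **`P(J_e ∩ {u ↔ ∞} ∩ {v ↔ ∞}) = P({u ↔ ∞} ∩ {v ↔ ∞}) − (1 − p) · P({u ↔ ∞, v ↔ ∞ off e})`** for every box
limit `P` (`0 ≤ p < 1`, `q ≥ 1`): off `J_e` the events `I_u ∩ I_v` and `H = {u ↔ ∞, v ↔ ∞ off e}` coincide, and
`P(J_eᶜ ∩ H) = (1 − p) P(H)`. [cite: Grimmett2006, §5.2, proof of Thm. (5.16)(c), eqs. (5.24)–(5.25)] -/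
theorem IsBoxLimit.real_edgeOpen_inter_percolatesAt_eq (hP : IsBoxLimit d b p q P) (hp : p ∈ Set.Ico (0 : ℝ) 1)
    (hq : 1 ≤ q) {u v : Site d} (huv : (zdGraph d).Adj u v) :
    P.real ({ω | s(u, v) ∈ ω} ∩ (percolatesAt u ∩ percolatesAt v)) =
      P.real (percolatesAt u ∩ percolatesAt v) -
        (1 - p) * P.real ((fun η : BondConfig (Site d) => η \ {s(u, v)}) ⁻¹' (percolatesAt u ∩ percolatesAt v)) := by
  haveI := hP.isProbabilityMeasure
  have hJm : MeasurableSet {ω : BondConfig (Site d) | s(u, v) ∈ ω} := measurableSet_mem _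
  set J : Set (BondConfig (Site d)) := {ω | s(u, v) ∈ ω} with hJ
  set I : Set (BondConfig (Site d)) := percolatesAt u ∩ percolatesAt v with hI
  set H : Set (BondConfig (Site d)) := (fun η : BondConfig (Site d) => η \ {s(u, v)}) ⁻¹' I with hH
  -- `I ∖ J = H ∖ J`: off `J_e`, deleting `e` does nothing
  have hset : I \ J = H \ J := by
    ext ω
    simp only [hH, Set.mem_sdiff, Set.mem_preimage, hJ, Set.mem_setOf_eq]
    constructor
    · rintro ⟨h, he⟩
      rw [diff_singleton_eq_self_of_notMem he]
      exact ⟨h, he⟩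
    · rintro ⟨h, he⟩
      rw [diff_singleton_eq_self_of_notMem he] at h
      exact ⟨h, he⟩
  have h1 := measureReal_inter_add_sdiff (μ := P) (s := I) hJm
  have h2 := measureReal_inter_add_sdiff (μ := P) (s := H) hJm
  have h3 : P.real (J ∩ H) = p * P.real H := hP.real_edgeOpen_inter_offEdgePerc_eq_mul hp hq huv
  rw [hset, Set.inter_comm I J] at h1
  rw [Set.inter_comm H J, h3] at h2
  linarith

end OneEdge

/-! ## `h¹(e) ≤ h⁰(e)` when `θ⁰ = θ¹` -/

section EdgeDensity

variable {d : ℕ} {p q : ℝ}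

/-- **Inclusion–exclusion replaces the coupling (5.22)**: if `θ⁰(p,q) = θ¹(p,q)` then
`φ¹_{p,q}(u ↔ ∞, v ↔ ∞) ≤ φ⁰_{p,q}(u ↔ ∞, v ↔ ∞)` — `φ^b(I_u ∩ I_v) = φ^b(I_u) + φ^b(I_v) − φ^b(I_u ∪ I_v)`, the
one-site terms agree (`θ⁰ = θ¹` at every site) and `I_u ∪ I_v` is increasing. [cite: Grimmett2006, §5.2, proof of Thm. (5.16)(c), eq. (5.22)] -/
theorem rcLimit_true_real_percolatesAt_inter_le_of_thetaFree_eq_thetaWired (hp : p ∈ Set.Icc (0 : ℝ) 1)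
    (hq : 1 ≤ q) (h : thetaFree d p q = thetaWired d p q) (u v : Site d) :
    (rcLimit d true p q).real (percolatesAt u ∩ percolatesAt v) ≤
      (rcLimit d false p q).real (percolatesAt u ∩ percolatesAt v) := by
  haveI := isProbabilityMeasure_rcLimit false p q (d := d)
  haveI := isProbabilityMeasure_rcLimit true p q (d := d)
  have hG0 : FKGibbs d p q (rcLimit d false p q) := (isBoxLimit_rcLimit false hp hq).fkGibbs hp hq
  have hG1 : FKGibbs d p q (rcLimit d true p q) := (isBoxLimit_rcLimit true hp hq).fkGibbs hp hq
  have hvm : MeasurableSet (percolatesAt v : Set (BondConfig (Site d))) := measurableSet_percolatesAt_holds v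
  have hum : MeasurableSet (percolatesAt u : Set (BondConfig (Site d))) := measurableSet_percolatesAt_holds u
  have h0 := measureReal_union_add_inter (μ := rcLimit d false p q) (s := percolatesAt u) hvm
  have h1 := measureReal_union_add_inter (μ := rcLimit d true p q) (s := percolatesAt u) hvm
  have hu : (rcLimit d true p q).real (percolatesAt u) = (rcLimit d false p q).real (percolatesAt u) :=
    hG1.real_percolatesAt_eq_of_thetaFree_eq_thetaWired hG0 hp hq h u
  have hv : (rcLimit d true p q).real (percolatesAt v) = (rcLimit d false p q).real (percolatesAt v) :=
    hG1.real_percolatesAt_eq_of_thetaFree_eq_thetaWired hG0 hp hq h v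
  have hU : (rcLimit d false p q).real (percolatesAt u ∪ percolatesAt v) ≤
      (rcLimit d true p q).real (percolatesAt u ∪ percolatesAt v) :=
    hG1.rcLimit_false_real_le_of_measurableSet hp hq
      ((isUpperSet_percolatesAt u).union (isUpperSet_percolatesAt v)) (hum.union hvm)
  linarith

/-- **`φ¹_{p,q}(J_e ∩ I_u ∩ I_v) ≤ φ⁰_{p,q}(J_e ∩ I_u ∩ I_v)` when `θ⁰(p,q) = θ¹(p,q)`** (`0 ≤ p < 1`, `q ≥ 1`,
`e = ⟨u,v⟩` a lattice edge): by `IsBoxLimit.real_edgeOpen_inter_percolatesAt_eq` for both limits, the previous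
lemma, and `φ⁰(H) ≤ φ¹(H)` for the increasing event `H = {u ↔ ∞, v ↔ ∞ off e}`.
[cite: Grimmett2006, §5.2, proof of Thm. (5.16)(c), eqs. (5.23)–(5.26)] -/
theorem rcLimit_true_real_edgeOpen_inter_percolatesAt_le_of_thetaFree_eq_thetaWired (hp : p ∈ Set.Ico (0 : ℝ) 1)
    (hq : 1 ≤ q) (h : thetaFree d p q = thetaWired d p q) {u v : Site d} (huv : (zdGraph d).Adj u v) :
    (rcLimit d true p q).real ({ω | s(u, v) ∈ ω} ∩ (percolatesAt u ∩ percolatesAt v)) ≤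
      (rcLimit d false p q).real ({ω | s(u, v) ∈ ω} ∩ (percolatesAt u ∩ percolatesAt v)) := by
  have hp' : p ∈ Set.Icc (0 : ℝ) 1 := ⟨hp.1, hp.2.le⟩
  haveI := isProbabilityMeasure_rcLimit true p q (d := d)
  have hG1 : FKGibbs d p q (rcLimit d true p q) := (isBoxLimit_rcLimit true hp' hq).fkGibbs hp' hq
  rw [(isBoxLimit_rcLimit true hp' hq).real_edgeOpen_inter_percolatesAt_eq hp hq huv,
    (isBoxLimit_rcLimit false hp' hq).real_edgeOpen_inter_percolatesAt_eq hp hq huv]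
  have hI := rcLimit_true_real_percolatesAt_inter_le_of_thetaFree_eq_thetaWired hp' hq h u v
  have hH : (rcLimit d false p q).real
        ((fun η : BondConfig (Site d) => η \ {s(u, v)}) ⁻¹' (percolatesAt u ∩ percolatesAt v)) ≤
      (rcLimit d true p q).real
        ((fun η : BondConfig (Site d) => η \ {s(u, v)}) ⁻¹' (percolatesAt u ∩ percolatesAt v)) := by
    refine hG1.rcLimit_false_real_le_of_measurableSet hp' hq ?_ ?_
    · exact ((isUpperSet_percolatesAt u).inter (isUpperSet_percolatesAt v)).preimage
        fun ω ω' hle => Set.sdiff_subset_sdiff_left hle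
    · exact ((measurableSet_percolatesAt_holds u).inter (measurableSet_percolatesAt_holds v)).preimage
        (measurable_closeEdges _)
  have hp1 : 0 ≤ 1 - p := sub_nonneg.2 hp.2.le
  nlinarith

/-- **`h¹(p,q)(e) ≤ h⁰(p,q)(e)` when `θ⁰(p,q) = θ¹(p,q)`** (`0 ≤ p < 1`, `q ≥ 1`, `e = ⟨u,v⟩` a lattice edge):
`φ¹_{p,q}(J_e) ≤ φ⁰_{p,q}(J_e)`, adding the bound on `J_e ∩ I_u ∩ I_v` to the free-island bound on
`J_e ∩ {u ↛ ∞, v ↛ ∞}` (`rcLimit_true_real_inter_finiteClusters_le_rcLimit_false`).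
[cite: Grimmett2006, §5.2, proof of Thm. (5.16)(c), eqs. (5.21)–(5.28)] -/
theorem rcLimit_true_real_edgeOpen_le_of_thetaFree_eq_thetaWired (hp : p ∈ Set.Ico (0 : ℝ) 1) (hq : 1 ≤ q)
    (h : thetaFree d p q = thetaWired d p q) {u v : Site d} (huv : (zdGraph d).Adj u v) :
    (rcLimit d true p q).real {ω | s(u, v) ∈ ω} ≤ (rcLimit d false p q).real {ω | s(u, v) ∈ ω} := by
  classical
  have hp' : p ∈ Set.Icc (0 : ℝ) 1 := ⟨hp.1, hp.2.le⟩
  haveI := isProbabilityMeasure_rcLimit false p q (d := d)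
  haveI := isProbabilityMeasure_rcLimit true p q (d := d)
  have hum : MeasurableSet (percolatesAt u : Set (BondConfig (Site d))) := measurableSet_percolatesAt_holds u
  -- split `J_e = (J_e ∩ I_u) ⊔ (J_e ∖ I_u)`; on `J_e`, `I_u = I_u ∩ I_v` and `I_uᶜ = {u ↛ ∞, v ↛ ∞}`
  have hsplit : ∀ μ : Measure (BondConfig (Site d)), IsFiniteMeasure μ →
      μ.real {ω | s(u, v) ∈ ω} = μ.real ({ω | s(u, v) ∈ ω} ∩ (percolatesAt u ∩ percolatesAt v)) +
        μ.real ({ω | s(u, v) ∈ ω} ∩ {ω | ∀ x ∈ ({u, v} : Finset (Site d)), ω ∉ percolatesAt x}) := by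
    intro μ _
    have h1 : {ω : BondConfig (Site d) | s(u, v) ∈ ω} ∩ percolatesAt u =
        {ω | s(u, v) ∈ ω} ∩ (percolatesAt u ∩ percolatesAt v) := by
      ext ω
      simp only [Set.mem_inter_iff, Set.mem_setOf_eq]
      exact ⟨fun ⟨he, hu⟩ => ⟨he, hu, (mem_percolatesAt_iff_of_mem huv.ne he).1 hu⟩,
        fun ⟨he, hu, _⟩ => ⟨he, hu⟩⟩
    have h2 : {ω : BondConfig (Site d) | s(u, v) ∈ ω} \ percolatesAt u =
        {ω | s(u, v) ∈ ω} ∩ {ω | ∀ x ∈ ({u, v} : Finset (Site d)), ω ∉ percolatesAt x} := by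
      ext ω
      simp only [Set.mem_sdiff, Set.mem_inter_iff, Set.mem_setOf_eq, Finset.mem_insert, Finset.mem_singleton,
        forall_eq_or_imp, forall_eq]
      exact ⟨fun ⟨he, hu⟩ => ⟨he, hu, fun hv => hu ((mem_percolatesAt_iff_of_mem huv.ne he).2 hv)⟩,
        fun ⟨he, hu, _⟩ => ⟨he, hu⟩⟩
    rw [← measureReal_inter_add_sdiff (s := {ω : BondConfig (Site d) | s(u, v) ∈ ω}) hum, h1, h2]
  rw [hsplit (rcLimit d true p q) inferInstance, hsplit (rcLimit d false p q) inferInstance]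
  refine add_le_add (rcLimit_true_real_edgeOpen_inter_percolatesAt_le_of_thetaFree_eq_thetaWired hp hq h huv) ?_
  -- the free-island bound, with `Λ = {u, v}`, `A = J_e` (increasing, determined by `E_{{u,v}} = {e}`)
  refine rcLimit_true_real_inter_finiteClusters_le_rcLimit_false hp' hq (fun ω ω' hle hω => hle hω)
    ((determinedBy_mem (s(u, v))).mono fun e he => ?_)
  rw [Set.mem_singleton_iff.1 he, Finset.mem_coe, mem_edgesIn_iff]
  refine ⟨(SimpleGraph.mem_edgeSet _).2 huv, fun x hx => ?_⟩
  rcases Sym2.mem_iff.1 hx with rfl | rfl <;> simp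

end EdgeDensity

/-! ## The theorem: `θ⁰(p,q) = θ¹(p,q) ⇒ φ⁰_{p,q} = φ¹_{p,q}` -/

section Main

variable {d : ℕ} {p q : ℝ} {P : Measure (BondConfig (Site d))}

/-- At `p = 1` the free and wired limits coincide (every lattice edge is almost surely open under both).
[cite: Grimmett2006, Thm. (4.63) (trivial endpoint p = 1)] -/
theorem rcLimit_false_eq_rcLimit_true_one_left (hq : 1 ≤ q) : rcLimit d false 1 q = rcLimit d true 1 q := by
  have hp : (1 : ℝ) ∈ Set.Icc (0 : ℝ) 1 := ⟨zero_le_one, le_rfl⟩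
  rcases Nat.eq_zero_or_pos d with hd | hd
  · exact (rcLimit_eq_false_of_eq_zero hd true 1 q).symm
  haveI := isProbabilityMeasure_rcLimit false (1 : ℝ) q (d := d)
  haveI := isProbabilityMeasure_rcLimit true (1 : ℝ) q (d := d)
  -- a lattice edge `e₀ = ⟨0, e_i⟩`
  set i : Fin d := ⟨0, hd⟩
  have he₀ : s((0 : Site d), (0 : Site d) + Pi.single i 1) ∈ (zdGraph d).edgeSet := by
    rw [SimpleGraph.mem_edgeSet, zdGraph_adj_iff]
    exact ⟨i, Or.inl rfl⟩
  rw [rcLimit_false_eq_rcLimit_true_iff_of_mem_edgeSet hp hq he₀,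
    ← (isBoxLimit_rcLimit false hp hq).real_setOf_mem_eq_freeEdgeDensity hp hq,
    ← (isBoxLimit_rcLimit true hp hq).real_setOf_mem_eq_wiredEdgeDensity hd hp hq]
  have hone : ∀ b : Bool, (rcLimit d b 1 q).real {ω | s((0 : Site d), (0 : Site d) + Pi.single i 1) ∈ ω} = 1 := by
    intro b
    haveI := isProbabilityMeasure_rcLimit b (1 : ℝ) q (d := d)
    have h0 := (isBoxLimit_rcLimit b hp hq).measure_setOf_not_mem_eq_zero_of_one_left (one_pos.trans_le hq) he₀
    have h0' : (rcLimit d b 1 q).real {ω | s((0 : Site d), (0 : Site d) + Pi.single i 1) ∈ ω}ᶜ = 0 := by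
      rw [Set.compl_setOf, measureReal_def, h0, ENNReal.toReal_zero]
    have h1 := measureReal_add_measureReal_compl (μ := rcLimit d b 1 q)
      (measurableSet_mem (s((0 : Site d), (0 : Site d) + Pi.single i 1)))
    rwa [h0', add_zero, probReal_univ] at h1
  rw [hone false, hone true]

/-- **Grimmett 2006, Thm. (5.16)(c) 'only if' / Thm. (5.33)(a)**: for the random-cluster model on `ℤ^d`
(`0 ≤ p ≤ 1`, `q ≥ 1`, every `d`), **if `θ⁰(p,q) = θ¹(p,q)` then `φ⁰_{p,q} = φ¹_{p,q}`** — equal free and wired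
percolation probabilities force a unique infinite-volume random-cluster measure. Proof: at a lattice edge
`h¹(e) ≤ h⁰(e)` (`rcLimit_true_real_edgeOpen_le_of_thetaFree_eq_thetaWired`) and `h⁰(e) ≤ h¹(e)`, then Thm. (4.63).
[cite: Grimmett2006, Thm. (5.16)(c) and Thm. (5.33)(a) (p. 107, [8, 152])] -/
theorem rcLimit_false_eq_rcLimit_true_of_thetaFree_eq_thetaWired (hp : p ∈ Set.Icc (0 : ℝ) 1) (hq : 1 ≤ q)
    (h : thetaFree d p q = thetaWired d p q) : rcLimit d false p q = rcLimit d true p q := by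
  rcases Nat.eq_zero_or_pos d with hd | hd
  · exact (rcLimit_eq_false_of_eq_zero hd true p q).symm
  rcases eq_or_lt_of_le hp.2 with hp1 | hp1
  · rw [hp1]; exact rcLimit_false_eq_rcLimit_true_one_left hq
  -- a lattice edge `e₀ = ⟨0, e_i⟩`
  set i : Fin d := ⟨0, hd⟩
  have hadj : (zdGraph d).Adj (0 : Site d) ((0 : Site d) + Pi.single i 1) := by
    rw [zdGraph_adj_iff]; exact ⟨i, Or.inl rfl⟩
  have he₀ : s((0 : Site d), (0 : Site d) + Pi.single i 1) ∈ (zdGraph d).edgeSet := by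
    rwa [SimpleGraph.mem_edgeSet]
  rw [rcLimit_false_eq_rcLimit_true_iff_of_mem_edgeSet hp hq he₀,
    ← (isBoxLimit_rcLimit false hp hq).real_setOf_mem_eq_freeEdgeDensity hp hq,
    ← (isBoxLimit_rcLimit true hp hq).real_setOf_mem_eq_wiredEdgeDensity hd hp hq]
  refine le_antisymm (rcLimit_real_false_le_true hp hq (isLocalEvent_setOf_mem _) fun ω ω' hle hω => hle hω) ?_
  exact rcLimit_true_real_edgeOpen_le_of_thetaFree_eq_thetaWired ⟨hp.1, hp1⟩ hq h hadj

/-- **Grimmett 2006, Thm. (5.16)(c)**: `φ⁰_{p,q} = φ¹_{p,q}` **iff** `θ⁰(p,q) = θ¹(p,q)` (`0 ≤ p ≤ 1`, `q ≥ 1`,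
every `d`; the 'if' half is FO-07b's `thetaFree_eq_thetaWired_of_rcLimit_false_eq_rcLimit_true`).
[cite: Grimmett2006, Thm. (5.16)(c) with Thm. (4.63)] -/
theorem rcLimit_false_eq_rcLimit_true_iff_thetaFree_eq_thetaWired (hp : p ∈ Set.Icc (0 : ℝ) 1) (hq : 1 ≤ q) :
    rcLimit d false p q = rcLimit d true p q ↔ thetaFree d p q = thetaWired d p q :=
  ⟨thetaFree_eq_thetaWired_of_rcLimit_false_eq_rcLimit_true hp hq,
    rcLimit_false_eq_rcLimit_true_of_thetaFree_eq_thetaWired hp hq⟩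

/-- **The cell's boundary-condition seam IS uniqueness of the infinite-volume measure**:
`FK.FKUniqueAt d p q` (`θ⁰(p,q) = θ¹(p,q)`) **iff** `φ⁰_{p,q} = φ¹_{p,q}` (`0 ≤ p ≤ 1`, `q ≥ 1`).
[cite: Grimmett2006, Thm. (5.16)(c) with Thm. (4.63)] -/
theorem fkUniqueAt_iff_rcLimit_false_eq_rcLimit_true (hp : p ∈ Set.Icc (0 : ℝ) 1) (hq : 1 ≤ q) :
    FKUniqueAt d p q ↔ rcLimit d false p q = rcLimit d true p q :=
  (fkUniqueAt_iff d p q).trans (rcLimit_false_eq_rcLimit_true_iff_thetaFree_eq_thetaWired hp hq).symm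

/-- **Thm. (5.33)(a) on the cell's class**: if `θ⁰(p,q) = θ¹(p,q)` (`0 ≤ p ≤ 1`, `q ≥ 1`), the sandwich class
`FKGibbs d p q` is the singleton `{φ⁰_{p,q}}` (FO-10a's (4.36) `FKGibbs.eq_rcLimit_of_rcLimit_false_eq_true`).
[cite: Grimmett2006, Thm. (5.33)(a) with Thm. (4.34) eq. (4.36)] -/
theorem fkGibbs_iff_eq_rcLimit_false_of_thetaFree_eq_thetaWired (hp : p ∈ Set.Icc (0 : ℝ) 1) (hq : 1 ≤ q)
    (h : thetaFree d p q = thetaWired d p q) : FKGibbs d p q P ↔ P = rcLimit d false p q := by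
  refine ⟨fun hP => hP.eq_rcLimit_of_rcLimit_false_eq_true hp hq
    (rcLimit_false_eq_rcLimit_true_of_thetaFree_eq_thetaWired hp hq h), ?_⟩
  rintro rfl
  exact (isBoxLimit_rcLimit false hp hq).fkGibbs hp hq

/-- Under the seam `FK.FKUniqueAt d p q` every measure of the class is `φ⁰_{p,q} = φ¹_{p,q}`. [cite: Grimmett2006, Thm. (5.33)(a)] -/
theorem FKGibbs.eq_rcLimit_false_of_fkUniqueAt (hP : FKGibbs d p q P) (hp : p ∈ Set.Icc (0 : ℝ) 1) (hq : 1 ≤ q)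
    (h : FKUniqueAt d p q) : P = rcLimit d false p q :=
  (fkGibbs_iff_eq_rcLimit_false_of_thetaFree_eq_thetaWired hp hq ((fkUniqueAt_iff d p q).1 h)).1 hP

/-- **`𝒟_q = {p : θ⁰(p,q) ≠ θ¹(p,q)}`**: the (at most countable, Thm. (4.63)) set of parameters at which the free and
wired measures differ is exactly the set where the two percolation probabilities differ (`q ≥ 1`).
[cite: Grimmett2006, Thm. (5.16)(c) and Thm. (4.63)] -/
theorem setOf_rcLimit_false_ne_rcLimit_true_eq {q : ℝ} (hq : 1 ≤ q) :
    {p : ℝ | p ∈ Set.Icc (0 : ℝ) 1 ∧ rcLimit d false p q ≠ rcLimit d true p q} =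
      {p : ℝ | p ∈ Set.Icc (0 : ℝ) 1 ∧ thetaFree d p q ≠ thetaWired d p q} := by
  ext p
  simp only [Set.mem_setOf_eq]
  exact and_congr_right fun hp => not_congr (rcLimit_false_eq_rcLimit_true_iff_thetaFree_eq_thetaWired hp hq)

/-- **Phase coexistence forces `θ⁰ < θ¹`**: if `φ⁰_{p,q} ≠ φ¹_{p,q}` (`0 ≤ p ≤ 1`, `q ≥ 1`) then
`θ⁰(p,q) < θ¹(p,q)` — in particular `θ¹(p,q) > 0` (`UniquenessOfNonPercolationTheta.lean`).
[cite: Grimmett2006, Thm. (5.16)(c) with (5.3)] -/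
theorem thetaFree_lt_thetaWired_of_rcLimit_false_ne_rcLimit_true (hp : p ∈ Set.Icc (0 : ℝ) 1) (hq : 1 ≤ q)
    (h : rcLimit d false p q ≠ rcLimit d true p q) : thetaFree d p q < thetaWired d p q :=
  lt_of_le_of_ne (thetaFree_le_thetaWired hp hq)
    fun heq => h (rcLimit_false_eq_rcLimit_true_of_thetaFree_eq_thetaWired hp hq heq)

end Main

end Summit.CriticalPhenomena.PercolationContinuityZ3.Theorems.FK

end
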